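import Mathlib.LinearAlgebra.Dual.Lemmas
import Mathlib.Algebra.Module.ZMod
import Mathlib.Algebra.Field.ZMod
import Mathlib.RingTheory.Finiteness.Cardinality
import HarnessLib

/-!
# The prime-choice covering lemma for an INDEPENDENT family plus one class (Sakamoto's Lemma 5.1)
# (cell `b2b-bsdres`, team n1011, row T-C55K-4 = appendix of T-C55K for route planner 1's R1-56
# "S24(1)@m=1 in the kernel", K2/K3 input of [S24] Lemma 6.4; file A — PURE ALGEBRA; seat p15)

HONEST FRAMING (cell `b2b-bsdres`, run/shared/lean/b2b/bsd-rank1-residual/, verbatim in every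
file): the goal of the cell is to DELETE the COMBINATION-SHAPED residual classes of the
Birch–Swinnerton-Dyer formula for ALL analytic-rank `≤ 1` elliptic curves over `ℚ` — "full BSD
formula for every rank `≤ 1` curve in class `C`" assembled STRICTLY from published theorems — so
that the rank-`≤ 1` remainder becomes exactly the CONSTRUCTION-SHAPED classes, which are TYPED
(missing-input `Prop`s), NOT attempted. This is not "finishing BSD". Team n1011 (N10/N11, the
additive block `X4 ∧ p = 3`): research route; TOOL theorems of linear algebra over `𝔽_p`, no class
theorem, nothing booked, no mark changed; no definition, no named fact, no `sorry`.

## What and why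

Row T-C55K proved Sakamoto's Cor. 5.5 (JTNB 36 (2024) p. 929: any `n ≤ p` non-zero classes have a
common good Kolyvagin prime).  [S24] Remark 5.4: "Lemma 5.2 is only used to prove Corollary 5.5 and
Lemma 6.4" — and Lemma 6.4 (pp. 931–932, the engine of the connectedness of the graph `𝒳⁰` of core
vertices, Cor. 6.6 / Thm. 6.7) invokes LEMMA 5.2 on FOUR classes whose span has dimension `≥ 3`;
by Remark 5.3 no "`n ≤ p`" statement can replace it at `p = 3`.  The group-theoretic core is
Lemma 5.1 (pp. 927–928): for non-zero `φ₁, …, φ₄ ∈ Hom(G, 𝔽₃^a)` spanning a space of dimension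
`≥ 3`, `⋃ gᵢ ker φᵢ ≠ G`.  This file proves it for `a = 1` (the programme's `F = 𝔽₃`) and every
odd `p`, in the form Lemma 6.4 actually uses — an `𝔽_p`-INDEPENDENT family of homomorphisms plus
ONE more — and in the `(F, Λ)` formalism of T-C55K's file 1 (`PrimeChoiceCovering.lean`):

* `exists_forall_apply_eq_of_ker_eq_bot` — if `F : 𝔽_p^ι →ₗ (G → 𝔽_p)` has every `F a` a
  homomorphism on `G` and `ker F = 0` (the `φᵢ = F eᵢ` are independent), then `g ↦ (φᵢ g)ᵢ` is
  ONTO `𝔽_p^ι` (the evaluations exhaust the dual space: their common zero locus is `0`);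
* `exists_forall_ne_and_sum_ne` — for `p ≥ 3`, prescribed `t`, `b ≠ 0`, `t′` there is `y ∈ 𝔽_p^ι`
  with `yᵢ ≠ tᵢ` for all `i` and `Σ bᵢ yᵢ ≠ t′` (two admissible values at a coordinate where
  `b ≠ 0` give different sums);
* `exists_forall_apply_add_ne_zero_of_ker_eq_bot` (independent family, any `p`) and
  `exists_forall_apply_add_ne_zero_and_sum_of_ker_eq_bot` (`p ≥ 3`; plus one DEPENDENT functional
  `Σ bᵢ φᵢ`, `b ≠ 0`, with a prescribed constant) — Sakamoto's Lemma 5.1 in the two cases of its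
  proof ("dimension 4" / "dimension 3"), stated so that file B can feed the restrictions of crossed
  homomorphisms to `G_F` and their values at `τ`.

References: R. Sakamoto, *The theory of Kolyvagin systems for p = 3*, JTNB **36** (2024), Lemma 5.1,
Lemma 5.2, Remarks 5.3–5.4 (pp. 927–929), Lemma 6.4 (pp. 931–932) [Sakamoto2024]; B. Mazur, K. Rubin,
Mem. AMS **799** (2004), Prop. 3.6.1 (pp. 30–31) [MazurRubin2004].
-/

namespace Summit.BirchSwinnertonDyer.Rank1Residual.GaloisImage.PrimeChoice

open Function Module

section Independent

variable {p : ℕ} [Fact p.Prime] {ι : Type*} [Fintype ι] [DecidableEq ι] {G : Type*} [Group G]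

/-- **Independent homomorphisms to `𝔽_p` are jointly onto.**  If `F : 𝔽_p^ι →ₗ (G → 𝔽_p)` has
every `F a` a homomorphism on the group `G` and trivial kernel (the `φᵢ = F eᵢ` are
`𝔽_p`-linearly independent in `Hom(G, 𝔽_p)`), then for every target `y ∈ 𝔽_p^ι` some `g ∈ G` has
`φᵢ(g) = yᵢ` for all `i` (Sakamoto, proof of Lemma 5.1: "the group homomorphism `G → 𝔽₃⁴` is
surjective").  Proof as in T-C55K file 1: the evaluations `g ↦ (a ↦ F a g)` form a subgroup of
the dual space whose common zero locus is `ker F = 0`, hence all of it.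
[cite: Sakamoto2024, Lemma 5.1 (pp. 927–928)] -/
theorem exists_forall_apply_eq_of_ker_eq_bot
    (F : (ι → ZMod p) →ₗ[ZMod p] (G → ZMod p))
    (hF : ∀ a g h, F a (g * h) = F a g + F a h) (hker : ∀ a, F a = 0 → a = 0)
    (y : ι → ZMod p) : ∃ g : G, ∀ i, F (Pi.single i 1) g = y i := by
  classical
  -- the evaluations `Φ g : a ↦ F a g` form a subgroup `B` of the dual space
  set Φ : G → Module.Dual (ZMod p) (ι → ZMod p) := fun g => (LinearMap.proj g).comp F with hΦ_def
  have hΦ : ∀ g a, Φ g a = F a g := fun g a => rfl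
  have hΦmul : ∀ g h, Φ (g * h) = Φ g + Φ h := fun g h =>
    LinearMap.ext fun a => by rw [LinearMap.add_apply, hΦ, hΦ, hΦ, hF]
  have hΦone : Φ 1 = 0 := by
    have h := hΦmul 1 1
    rw [mul_one] at h
    exact left_eq_add.mp h
  have hΦinv : ∀ g, Φ g⁻¹ = -Φ g := fun g => by
    have h := hΦmul g g⁻¹
    rw [mul_inv_cancel, hΦone] at h
    exact (neg_eq_of_add_eq_zero_right h.symm).symm
  let B₀ : AddSubgroup (Module.Dual (ZMod p) (ι → ZMod p)) :=
    { carrier := Set.range Φ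
      add_mem' := by
        rintro _ _ ⟨g, rfl⟩ ⟨h, rfl⟩
        exact ⟨g * h, hΦmul g h⟩
      zero_mem' := ⟨1, hΦone⟩
      neg_mem' := by
        rintro _ ⟨g, rfl⟩
        exact ⟨g⁻¹, hΦinv g⟩ }
  set B : Submodule (ZMod p) (Module.Dual (ZMod p) (ι → ZMod p)) :=
    AddSubgroup.toZModSubmodule p B₀ with hB_def
  have hmemB : ∀ β, β ∈ B ↔ β ∈ Set.range Φ := fun β => Iff.rfl
  -- its common zero locus is `ker F = 0`, so `B` is the whole dual space
  have hBco : B.dualCoannihilator = ⊥ := by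
    rw [eq_bot_iff]
    intro x hx
    rw [Submodule.mem_dualCoannihilator] at hx
    have h0 : F x = 0 := funext fun g => hx (Φ g) ((hmemB _).mpr ⟨g, rfl⟩)
    rw [Submodule.mem_bot]
    exact hker x h0
  have hBtop : B = ⊤ := by
    rw [← Subspace.dualCoannihilator_dualAnnihilator_eq (W := B), hBco,
      Submodule.dualAnnihilator_bot]
  -- the functional `a ↦ Σ aᵢ yᵢ` is an evaluation
  obtain ⟨g, hg⟩ : Fintype.linearCombination (ZMod p) y ∈ Set.range Φ := by
    rw [← hmemB, hBtop]
    exact Submodule.mem_top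
  refine ⟨g, fun i => ?_⟩
  rw [← hΦ, hg, Fintype.linearCombination_apply_single, one_smul]

/-- **Avoidance with one affine condition** (`p ≥ 3`): for `t ∈ 𝔽_p^ι`, `b ≠ 0` and `t′` there is
`y` with `yᵢ ≠ tᵢ` for every `i` and `Σ bᵢ yᵢ ≠ t′` — Sakamoto's "the set
`{h | prᵢ(gᵢ) ≠ hᵢ}` is not contained in `g₄ + ker φ₄`" (proof of Lemma 5.1, case of dimension 3):
start from `yᵢ = tᵢ + 1`; if the sum is wrong, add `1` at a coordinate `j₀` with `b_{j₀} ≠ 0`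
(`tⱼ₀ + 2 ≠ tⱼ₀` as `p ≠ 2`). [cite: Sakamoto2024, Lemma 5.1 (p. 928)] -/
theorem exists_forall_ne_and_sum_ne (hp : 3 ≤ p) (t : ι → ZMod p) {b : ι → ZMod p} (hb : b ≠ 0)
    (t' : ZMod p) : ∃ y : ι → ZMod p, (∀ i, y i ≠ t i) ∧ ∑ i, b i * y i ≠ t' := by
  classical
  have h2 : (2 : ZMod p) ≠ 0 := by
    intro h
    have h' : ((2 : ℕ) : ZMod p) = 0 := by exact_mod_cast h
    rw [ZMod.natCast_eq_zero_iff] at h'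
    have := Nat.le_of_dvd two_pos h'
    omega
  obtain ⟨j₀, hj₀⟩ : ∃ j, b j ≠ 0 := by
    by_contra h
    push Not at h
    exact hb (funext h)
  let y₀ : ι → ZMod p := fun i => t i + 1
  have hy₀t : ∀ i, y₀ i ≠ t i := fun i h => one_ne_zero (add_eq_left.mp h)
  by_cases hs : ∑ i, b i * y₀ i = t'
  · -- move coordinate `j₀` by one more step
    let y₁ : ι → ZMod p := fun i => if i = j₀ then t i + 2 else t i + 1
    refine ⟨y₁, fun i => ?_, ?_⟩
    · by_cases hi : i = j₀
      · simp only [y₁, if_pos hi]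
        exact fun h => h2 (add_eq_left.mp h)
      · simp only [y₁, if_neg hi]
        exact fun h => one_ne_zero (add_eq_left.mp h)
    · have hdiff : ∀ i, b i * y₁ i = b i * y₀ i + (if i = j₀ then b i else 0) := by
        intro i
        by_cases hi : i = j₀
        · simp only [y₁, y₀, if_pos hi]
          ring
        · simp only [y₁, y₀, if_neg hi, add_zero]
      have hsum : ∑ i, b i * y₁ i = t' + b j₀ := by
        rw [Finset.sum_congr rfl fun i _ => hdiff i, Finset.sum_add_distrib, hs,
          Finset.sum_ite_eq' Finset.univ j₀ b, if_pos (Finset.mem_univ _)]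
      rw [hsum]
      exact fun h => hj₀ (add_eq_left.mp h)
  · exact ⟨y₀, hy₀t, hs⟩

/-- **Sakamoto's Lemma 5.1, independent case** (his "dimension 4"): for an independent family
`φᵢ = F eᵢ` of homomorphisms `G → 𝔽_p` and any constants `λᵢ`, some `g ∈ G` has `φᵢ(g) + λᵢ ≠ 0`
for every `i` (in file B: `φᵢ` = the `i`-th crossed homomorphism restricted to
`G_F = Gal(K̄/K(T̄, μ_N))` modulo `(τ − 1)T̄`, `λᵢ` = its value at `τ`).  Any prime `p`.
[cite: Sakamoto2024, Lemma 5.1 (pp. 927–928)] [cite: MazurRubin2004, Prop. 3.6.1 proof, p. 31] -/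
theorem exists_forall_apply_add_ne_zero_of_ker_eq_bot
    (F : (ι → ZMod p) →ₗ[ZMod p] (G → ZMod p))
    (hF : ∀ a g h, F a (g * h) = F a g + F a h) (hker : ∀ a, F a = 0 → a = 0)
    (lam : ι → ZMod p) : ∃ g : G, ∀ i, F (Pi.single i 1) g + lam i ≠ 0 := by
  obtain ⟨g, hg⟩ := exists_forall_apply_eq_of_ker_eq_bot F hF hker fun i => 1 - lam i
  exact ⟨g, fun i => by rw [hg i, sub_add_cancel]; exact one_ne_zero⟩

/-- **Sakamoto's Lemma 5.1, dependent case** (his "dimension 3"; `p ≥ 3`): for an independent family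
`φᵢ = F eᵢ : G → 𝔽_p`, constants `λᵢ`, ONE MORE functional `Σ bᵢ φᵢ` with `b ≠ 0` and a constant
`λ′`, some `g ∈ G` has `φᵢ(g) + λᵢ ≠ 0` for every `i` AND `Σ bᵢ φᵢ(g) + λ′ ≠ 0`.
[cite: Sakamoto2024, Lemma 5.1 (p. 928)] -/
theorem exists_forall_apply_add_ne_zero_and_sum_of_ker_eq_bot (hp : 3 ≤ p)
    (F : (ι → ZMod p) →ₗ[ZMod p] (G → ZMod p))
    (hF : ∀ a g h, F a (g * h) = F a g + F a h) (hker : ∀ a, F a = 0 → a = 0)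
    (lam : ι → ZMod p) {b : ι → ZMod p} (hb : b ≠ 0) (lam' : ZMod p) :
    ∃ g : G, (∀ i, F (Pi.single i 1) g + lam i ≠ 0) ∧
      ∑ i, b i * F (Pi.single i 1) g + lam' ≠ 0 := by
  obtain ⟨y, hy, hsum⟩ := exists_forall_ne_and_sum_ne hp (fun i => -lam i) hb (-lam')
  obtain ⟨g, hg⟩ := exists_forall_apply_eq_of_ker_eq_bot F hF hker y
  refine ⟨g, fun i => ?_, ?_⟩
  · rw [hg i]
    intro h
    exact hy i (eq_neg_of_add_eq_zero_left h)
  · simp only [hg]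
    intro h
    exact hsum (eq_neg_of_add_eq_zero_left h)

/-! ### A consumer adapter: three elements, two independent and the third off their span -/

/-- In a group killed by `p`, `ℕ`-multiples depend only on the residue mod `p`. [folklore] -/
theorem val_mul_smul_eq {X : Type*} [AddCommGroup X] (hX : ∀ x : X, p • x = 0) (u v : ZMod p)
    (x : X) : (u * v).val • x = u.val • v.val • x := by
  rw [← mul_smul, ZMod.val_mul]
  conv_rhs => rw [← Nat.mod_add_div (u.val * v.val) p, add_smul, mul_smul, hX, add_zero]

/-- In a group killed by `p`, `(−v).val • x = −(v.val • x)`. [folklore] -/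
theorem neg_val_smul_eq {X : Type*} [AddCommGroup X] (hX : ∀ x : X, p • x = 0) (v : ZMod p)
    (x : X) : (-v).val • x = -(v.val • x) := by
  rw [eq_neg_iff_add_eq_zero, ← add_smul]
  have h : p ∣ (-v).val + v.val := by
    rw [← ZMod.natCast_eq_zero_iff, Nat.cast_add, ZMod.natCast_zmod_val, ZMod.natCast_zmod_val,
      neg_add_cancel]
  obtain ⟨k, hk⟩ := h
  rw [hk, mul_smul, hX]

/-- **The independence hypothesis of the four-class prime choice from subgroup-style data**: in a
group `X` killed by `p` (e.g. `H¹(K, T̄)` for `T̄` killed by `p`), if `c₁, c₂` are independent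
(`a·c₁ + b·c₂ = 0 ⟹ a = b = 0`) and `c₃` is not an `𝔽_p`-combination of them, then the family
`![c₁, c₂, c₃]` is `𝔽_p`-linearly independent in the `ℕ`-multiple form
`Σ ãᵢ cᵢ = 0 ⟹ a = 0` used by `exists_forall_apply_add_ne_zero…` / file C's `…_four`
(Sakamoto's "`dim_𝔽₃ ≥ 3`" in Lemma 6.4: `H¹_𝓕(e₁) = H¹_𝓕(d₁) ⊕ H¹_{𝓕^*}(e₁)` and `c₂⁽²⁾ ∉ H¹_𝓕(e₁)`).
[cite: Sakamoto2024, Lemma 5.2 (p. 928) and Lemma 6.4 (pp. 931–932)] -/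
theorem forall_sum_val_smul_eq_zero_fin_three {X : Type*} [AddCommGroup X] (hX : ∀ x : X, p • x = 0)
    {c₁ c₂ c₃ : X} (h12 : ∀ a b : ZMod p, a.val • c₁ + b.val • c₂ = 0 → a = 0 ∧ b = 0)
    (h3 : ∀ a b : ZMod p, a.val • c₁ + b.val • c₂ ≠ c₃) :
    ∀ a : Fin 3 → ZMod p, (∑ i, (a i).val • ![c₁, c₂, c₃] i) = 0 → a = 0 := by
  intro a h
  rw [Fin.sum_univ_three] at h
  simp only [Matrix.cons_val_zero, Matrix.cons_val_one, Matrix.cons_val] at h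
  by_cases h2 : a 2 = 0
  · rw [h2, ZMod.val_zero, zero_smul, add_zero] at h
    obtain ⟨h0, h1⟩ := h12 _ _ h
    funext i
    fin_cases i
    · exact h0
    · exact h1
    · exact h2
  · exfalso
    set u : ZMod p := (a 2)⁻¹ with hu
    have h1 : (1 : ZMod p).val • c₃ = c₃ := by rw [ZMod.val_one, one_smul]
    have hu2 : u * a 2 = 1 := inv_mul_cancel₀ h2
    -- multiply the relation by `u`
    have h' := congrArg (fun x => u.val • x) h
    simp only [smul_add, smul_zero, ← val_mul_smul_eq hX] at h'
    rw [hu2, h1, ← eq_neg_iff_add_eq_zero] at h'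
    have h'' : (-(u * a 0)).val • c₁ + (-(u * a 1)).val • c₂ = c₃ := by
      rw [neg_val_smul_eq hX, neg_val_smul_eq hX, ← neg_add, h', neg_neg]
    exact h3 _ _ h''

end Independent

end Summit.BirchSwinnertonDyer.Rank1Residual.GaloisImage.PrimeChoice
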